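import Literature.AlgebraicGeometry.ShimuraVarieties.UnitaryCurveComplexSliceHeckeOrbitExt   -- ★ p849682 (mine): maps agreeing on one Hecke orbit are equal; re-exports ★ E5 `UnitaryCurveSiegelDescent`
import HarnessLib

/-!
# The conjugate of one complex slice of the unitary Shimura CURVE by `σ ∈ Aut(ℂ∕τL)` equals a SECOND slice, given ONE twisted reciprocity law at a special point
# ([Milne 2005] Thm. 13.6 p. 118, the square of L29–41 with two different slices; [Shimura 1998] §18.6 ∕ [RapoportSmithlingZhang2020] §3.2: the twist)

Topic `AlgebraicGeometry/ShimuraVarieties`, namespace `…ShimuraVarieties.UnitaryCanonicalModel` (the object of ★ `UnitaryShimuraCurveRecord`).  THEOREMS ONLY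
(no definition, no instance, no notation, no named fact, no `sorry`).  Cell `hodgecm-mathlib` (D-0151), P6 «MOD programme», crux hLiu418 (stmt-HodgeConjecture-24832,
`--supports`, count-neutral), line «L4», X-LEAF `Lines/F0_P6a_EExports.lean` (A-p01 (g28)) socket `stub_ESHEET`, organ map `MEMO-ESHEET-organs.v2` **(S3)
«THE CONJUGATE SLICE EQUALS THE TENSORED SLICE: `T′ = ψ_𝔞`»** (LA4-plan (g2) DEAL #27 → LA4-p03 (g2)).  THE GENERIC FORM OF (S3) — the square of ★ E5
`RecordSystemGS.map_conj_eq_sliceComplex_of_recip` ∕ `gal_comp_sliceComplex` with the TARGET reciprocity TWISTED into a SECOND slice: there one slice `ψ` with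
point map `f` obeying `σ • f[x₀, b] = f[x₀, d·b]` gives `σ|_L⁻¹(ψ) = ψ`; here TWO slices `ψ, ψ₂ : (M_K)_τ → M_ℂ` with point maps `f, f₂` and ONE twisted law
«`σ|_ℚ • f[x₀, d′·b] = f₂[x₀, b]` for all `b`» at ONE special point `x₀ = [τw]` (`d′` the twist of the record's own reciprocity at `σ⁻¹`) give `σ⁻¹(ψ) = ψ₂` —
precisely (S3) with `ψ :=` the complex slice of `stub_E4`, `σ := γ̃ ∈ Aut(ℂ∕ι₁F)` reading `γ ∈ Gal(Fᵢ∕F)`, `ψ₂ := ψ_𝔞` the classifying map of the Serre-tensored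
family (S1), and the twisted law = (S2a) (reciprocity with the central twist `b̃(z(s))`, ★ p849704∕p849722, LA6-p02) composed with (S2b) (`ψ_𝔞 [v, a] =
pts⁻¹[J v, b(a)·b̃(z)]`, ★ p849685, LA4-p05) in the chart currency of (S8) — which this Literature organ takes BY VALUE as the one hypothesis `htw`.
HONEST LABEL: HC_CM is proved only modulo the 2 remaining named inputs (hLiu418 24832, h413 24833) until rung 0 closes; this file is generic and count-neutral.

THE MATHEMATICS ([Milne2005ShimuraVarieties] p. 118 L29–41: for `P = pts⁻¹[x₀, aK]`, `σ⁻¹(ψ)(P) = σ • ψ(σ_L⁻¹ • P) = σ • f[x₀, d′ aK]` by the canonical model's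
reciprocity at `σ⁻¹` (record field `recip`, twist `d′` of the Artin correspondent `s′` of `σ⁻¹`), and this is `f₂[x₀, aK] = ψ₂(P)` by the twisted law; so
`σ⁻¹(ψ)` and `ψ₂` agree on the Hecke orbit of `x₀`, dense in `Sh_K(ℂ)` (Lemma 13.5, ★ `RecordSystemGS.sliceComplex_ext_of_heckeOrbit_pts`), hence are equal).
* §1 **`RecordSystemGS.map_conj_eq_sliceTwo_of_twisted_recip`** — the pointwise square on the Hecke orbit of `x₀` (E5 §2 twin);
* §2 **`RecordSystemGS.conjSlice_eq_sliceTwo_of_twisted_recip`** — THE HEAD: every `T′` over the conjugate `(1 × Spec σ_L) ≫ ψ ≫ (1 × Spec σ|_ℚ⁻¹)` equals `ψ₂`;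
  **`RecordSystemGS.gal_comp_sliceComplex_comp_gal_eq_sliceTwo`** — the same on underlying morphisms: `gal σL⁻¹ ≫ ψ.left ≫ gal σ|_ℚ = ψ₂.left`.

## References
* [Milne2005ShimuraVarieties] J. S. Milne, *Introduction to Shimura varieties* (2005; rev. 2017), §13: Lemma 13.5 and Thm. 13.6 p. 118 (L29–41); Def. 12.8 (62) p. 114.
* [Shimura1998] G. Shimura, *Abelian Varieties with Complex Multiplication and Modular Functions* (1998), §18.6 (pp. 124–127).
* [RapoportSmithlingZhang2020Diagonal] M. Rapoport, B. Smithling, W. Zhang (2020), §3.2 p. 11 (the twists between the sheets of `M ⊗_F Fᵢ`).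
* [Deligne1979ShimuraVarieties] P. Deligne, *Variétés de Shimura* (1979), 2.2.4–2.2.6.
-/

set_option autoImplicit false

noncomputable section

open Function MulAction Topology NumberField IsDedekindDomain CategoryTheory CategoryTheory.Limits Matrix
  AlgebraicGeometry Cardinal
open scoped Matrix ComplexOrder
open Literature.AlgebraicGeometry.Motives Literature.NumberTheory.Automorphic Literature.NumberTheory.Automorphic.UnitaryGroup
open Literature.NumberTheory.Automorphic.Liu2021.AppendixC (C5.OpenCompactSubgroup C5.SmallLevel)
open Literature.AlgebraicGeometry.Motives.AbelianVariety (bcSpec bcFunctor specAut)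

namespace Literature.AlgebraicGeometry.ShimuraVarieties.UnitaryCanonicalModel

variable {L : Type} [Field L] [NumberField L] [IsCMField L] {Jstar : Matrix (Fin 2) (Fin 2) L} {τ : L →+* ℂ}
  {K₀ : C5.OpenCompactSubgroup ↥(finAdelic (↥(maximalRealSubfield L)) L (IsCMField.complexConj L) 2 Jstar)}

omit [IsCMField L] in
/-- `specAut` only sees the underlying ring map: an automorphism over `τL` and its restriction of scalars to `ℚ` have the same `Spec`. [folklore] -/
private theorem specAut_restrictScalars_rat (σL : letI : Algebra L ℂ := τ.toAlgebra; ℂ ≃ₐ[L] ℂ) :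
    letI : Algebra L ℂ := τ.toAlgebra
    specAut ℂ σL = specAut ℂ (σL.restrictScalars ℚ) := by
  letI : Algebra L ℂ := τ.toAlgebra
  have hh : (σL : ℂ →+* ℂ) = ((σL.restrictScalars ℚ : ℂ ≃ₐ[ℚ] ℂ) : ℂ →+* ℂ) := RingHom.ext fun _ => rfl
  change Spec.map (CommRingCat.ofHom (σL : ℂ →+* ℂ)) = Spec.map (CommRingCat.ofHom ((σL.restrictScalars ℚ : ℂ ≃ₐ[ℚ] ℂ) : ℂ →+* ℂ))
  rw [hh]

section TwoSlices

variable (S : RecordSystemGS L Jstar τ K₀) (K : C5.SmallLevel K₀) (M : SchemeOver ℚ)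
  (f f₂ : ShimuraSetGS L Jstar τ K.1.1 → ComplexPoints M)
  (ψ ψ₂ : (Motives.baseChangeHom τ).obj (S.M.obj K) ⟶ (Motives.baseChange ℚ ℂ).obj M)
  (hψ : letI : Algebra L ℂ := τ.toAlgebra
    ∀ P : ComplexPoints (S.M.obj K),
      (AlgPoints.map ψ (AlgPoints.baseChangeEquiv τ (S.M.obj K) P)).left ≫ Motives.baseChangeHomFst (algebraMap ℚ ℂ) M =
        (f (S.pts K P)).left)
  (hψ₂ : letI : Algebra L ℂ := τ.toAlgebra
    ∀ P : ComplexPoints (S.M.obj K),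
      (AlgPoints.map ψ₂ (AlgPoints.baseChangeEquiv τ (S.M.obj K) P)).left ≫ Motives.baseChangeHomFst (algebraMap ℚ ℂ) M =
        (f₂ (S.pts K P)).left)
  (t : letI : Algebra L ℂ := τ.toAlgebra; GaloisDescent.bc ℂ (S.M.obj K) ⟶ GaloisDescent.bc ℂ M) (ht : t = ψ.left)
  (t₂ : letI : Algebra L ℂ := τ.toAlgebra; GaloisDescent.bc ℂ (S.M.obj K) ⟶ GaloisDescent.bc ℂ M) (ht₂ : t₂ = ψ₂.left)

/-! ### §1 The square on the Hecke orbit of a special point (`t = ψ.left`, `t₂ = ψ₂.left` read on the fibre products, as in ★ E5) -/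

set_option maxHeartbeats 800000 in -- large adelic ∕ Shimura-set terms: instance-heavy statements (as ★ `UnitaryCurveSiegelDescent` §2)
include hψ hψ₂ ht ht₂ in
/-- **The conjugate `σ_L⁻¹(ψ)` agrees with the SECOND slice `ψ₂` on the Hecke orbit of a special point, given ONE twisted reciprocity law** (the square of
[Milne2005ShimuraVarieties] p. 118 L33–39 with two slices): for `σL ∈ Aut(ℂ∕τL)`, the Artin correspondent `s′` of `σL⁻¹` with its twist `d′` at `x₀ = [τ w]`, ANY `T′`
with underlying morphism `(1 × Spec σL) ≫ ψ ≫ (1 × Spec σL|_ℚ⁻¹)`, and the twisted law `σL|_ℚ • f[x₀, d′·b] = f₂[x₀, b]` (all `b`): `T′(P) = ψ₂(P)` for `P = pts⁻¹[x₀, aK]` — the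
record՚s `recip` at `σL⁻¹` moves `P` to `pts⁻¹[x₀, d′aK]`, `ψ` reads `f`, and the twisted law lands on `f₂[x₀, aK] = ψ₂(P)`.
[cite: Milne2005ShimuraVarieties, Thm. 13.6 p. 118 L29–39; Def. 12.8 (62) p. 114] [cite: Shimura1998, §18.6 (pp. 124–127)] -/
theorem RecordSystemGS.map_conj_eq_sliceTwo_of_twisted_recip
    (σL : letI : Algebra L ℂ := τ.toAlgebra; ℂ ≃ₐ[L] ℂ)
    {w : Fin 2 → L} (hw : (fun i => τ (w i)) ∈ negCone (Jstar.map τ)) {s' : (FiniteAdeleRing (𝓞 L) L)ˣ}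
    (hs' : letI : Algebra L ℂ := τ.toAlgebra; IsArtinCorrespondent L τ s' σL⁻¹.toRingEquiv)
    {d' : ↥(finAdelic (↥(maximalRealSubfield L)) L (IsCMField.complexConj L) 2 Jstar)}
    (hd' : IsDiagTwistGS L Jstar w (recipFactor L s') d')
    (T' : (Motives.baseChangeHom τ).obj (S.M.obj K) ⟶ (Motives.baseChange ℚ ℂ).obj M)
    (hT' : letI : Algebra L ℂ := τ.toAlgebra
      GaloisDescent.gal ℂ (S.M.obj K) σL⁻¹ ≫ t ≫ GaloisDescent.gal ℂ M (σL.restrictScalars ℚ) = T'.left)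
    (htw : letI : Algebra L ℂ := τ.toAlgebra
      ∀ b : ↥(finAdelic (↥(maximalRealSubfield L)) L (IsCMField.complexConj L) 2 Jstar),
        (σL.restrictScalars ℚ) • f (ShimuraSetGS.mk L Jstar τ K.1.1 (fun i => τ (w i)) hw (d' * b)) =
          f₂ (ShimuraSetGS.mk L Jstar τ K.1.1 (fun i => τ (w i)) hw b))
    (a : ↥(finAdelic (↥(maximalRealSubfield L)) L (IsCMField.complexConj L) 2 Jstar)) :
    letI : Algebra L ℂ := τ.toAlgebra
    AlgPoints.map T' (AlgPoints.baseChangeEquiv τ (S.M.obj K)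
        ((S.pts K).symm (ShimuraSetGS.mk L Jstar τ K.1.1 (fun i => τ (w i)) hw a))) =
      AlgPoints.map ψ₂ (AlgPoints.baseChangeEquiv τ (S.M.obj K)
        ((S.pts K).symm (ShimuraSetGS.mk L Jstar τ K.1.1 (fun i => τ (w i)) hw a))) := by
  letI iL : Algebra L ℂ := τ.toAlgebra
  have hspec : specAut ℂ σL = specAut ℂ (σL.restrictScalars ℚ) := specAut_restrictScalars_rat σL
  -- the record's reciprocity at `σL⁻¹`
  have rS : ∀ b, σL⁻¹ • (S.pts K).symm (ShimuraSetGS.mk L Jstar τ K.1.1 (fun i => τ (w i)) hw b) =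
      (S.pts K).symm (ShimuraSetGS.mk L Jstar τ K.1.1 (fun i => τ (w i)) hw (d' * b)) :=
    S.recip K σL⁻¹ s' hs' w hw d' hd'
  -- the two slices read `f`, `f₂` on the points `(P, 1)`
  have FT : ∀ b, pullback.lift ((S.pts K).symm (ShimuraSetGS.mk L Jstar τ K.1.1 (fun i => τ (w i)) hw b)).toSpecHom
        (𝟙 (Spec (.of ℂ))) (toSpecHom_comp_hom_eq (τ := τ) (S.M.obj K) _) ≫ t =
      pullback.lift (f (ShimuraSetGS.mk L Jstar τ K.1.1 (fun i => τ (w i)) hw b)).toSpecHom (𝟙 (Spec (.of ℂ)))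
        (toSpecHom_comp_hom_eq (τ := algebraMap ℚ ℂ) M _) := by
    intro b
    have h := S.lift_comp_sliceComplex_left K M f ψ hψ t ht
      ((S.pts K).symm (ShimuraSetGS.mk L Jstar τ K.1.1 (fun i => τ (w i)) hw b))
    rwa [Homeomorph.apply_symm_apply] at h
  have FT₂ : ∀ b, pullback.lift ((S.pts K).symm (ShimuraSetGS.mk L Jstar τ K.1.1 (fun i => τ (w i)) hw b)).toSpecHom
        (𝟙 (Spec (.of ℂ))) (toSpecHom_comp_hom_eq (τ := τ) (S.M.obj K) _) ≫ t₂ =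
      pullback.lift (f₂ (ShimuraSetGS.mk L Jstar τ K.1.1 (fun i => τ (w i)) hw b)).toSpecHom (𝟙 (Spec (.of ℂ)))
        (toSpecHom_comp_hom_eq (τ := algebraMap ℚ ℂ) M _) := by
    intro b
    have h := S.lift_comp_sliceComplex_left K M f₂ ψ₂ hψ₂ t₂ ht₂
      ((S.pts K).symm (ShimuraSetGS.mk L Jstar τ K.1.1 (fun i => τ (w i)) hw b))
    rwa [Homeomorph.apply_symm_apply] at h
  set P := (S.pts K).symm (ShimuraSetGS.mk L Jstar τ K.1.1 (fun i => τ (w i)) hw a) with hP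
  apply Over.OverMorphism.ext
  change (AlgPoints.baseChangeEquiv τ (S.M.obj K) P).left ≫ T'.left =
    (AlgPoints.baseChangeEquiv τ (S.M.obj K) P).left ≫ ψ₂.left
  rw [← lift_eq_baseChangeEquiv_left, ← hT', ← ht₂]
  change pullback.lift P.toSpecHom (𝟙 (Spec (.of ℂ))) (toSpecHom_comp_hom_eq (τ := τ) (S.M.obj K) P) ≫
      (GaloisDescent.gal ℂ (S.M.obj K) σL⁻¹ ≫ t ≫ GaloisDescent.gal ℂ M (σL.restrictScalars ℚ)) =
    pullback.lift P.toSpecHom (𝟙 (Spec (.of ℂ))) (toSpecHom_comp_hom_eq (τ := τ) (S.M.obj K) P) ≫ t₂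
  have step1 : pullback.lift P.toSpecHom (𝟙 (Spec (.of ℂ))) (toSpecHom_comp_hom_eq (τ := τ) (S.M.obj K) P) ≫
      GaloisDescent.gal ℂ (S.M.obj K) σL⁻¹ =
      specAut ℂ σL ≫ pullback.lift (σL⁻¹ • P).toSpecHom (𝟙 (Spec (.of ℂ)))
        (toSpecHom_comp_hom_eq (τ := τ) (S.M.obj K) (σL⁻¹ • P)) := by
    have h := lift_comp_gal (τ := τ) (S.M.obj K) σL⁻¹ P
    rwa [inv_inv] at h
  have step3 : ∀ Q : ComplexPoints M,
      pullback.lift Q.toSpecHom (𝟙 (Spec (.of ℂ))) (toSpecHom_comp_hom_eq (τ := algebraMap ℚ ℂ) M Q) ≫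
          GaloisDescent.gal ℂ M (σL.restrictScalars ℚ) =
        specAut ℂ (σL.restrictScalars ℚ)⁻¹ ≫ pullback.lift ((σL.restrictScalars ℚ) • Q).toSpecHom (𝟙 (Spec (.of ℂ)))
          (toSpecHom_comp_hom_eq (τ := algebraMap ℚ ℂ) M ((σL.restrictScalars ℚ) • Q)) :=
    fun Q => lift_comp_gal (τ := algebraMap ℚ ℂ) M (σL.restrictScalars ℚ) Q
  rw [← Category.assoc, step1, Category.assoc, hP, rS a, ← Category.assoc (pullback.lift _ _ _), FT (d' * a),
    step3, htw a, ← Category.assoc, hspec, AbelianVariety.specAut_comp_specAut_symm, Category.id_comp, FT₂ a]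

/-! ### §2 The head: the conjugate slice IS the second slice -/

set_option maxHeartbeats 800000 in -- large adelic ∕ Shimura-set terms: instance-heavy statements (as ★ `UnitaryCurveSiegelDescent` §3)
include hψ hψ₂ ht ht₂ in
/-- **THE CONJUGATE OF `ψ` BY `σL ∈ Aut(ℂ∕τL)` EQUALS THE SECOND SLICE `ψ₂`** (the (S3) shape `T′ = ψ_𝔞`): `M` separated over `ℚ`, `J⋆` `c`-hermitian with unit
determinant, `e`∕`he` the junction of ★ `gal_comp_sliceComplex` between the complex points of `(M_K)_τ` and `Sh_K(ℂ)`; for a special `x₀ = [τw]`, the Artin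
correspondent `s′` of `σL⁻¹` with its twist `d′`, and the twisted law `σL|_ℚ • f[x₀, d′·b] = f₂[x₀, b]` for all `b`: every `T′` over
`(1 × Spec σL) ≫ ψ ≫ (1 × Spec σL|_ℚ⁻¹)` EQUALS `ψ₂` (§1 on the Hecke orbit of `x₀`, then density ★ `RecordSystemGS.sliceComplex_ext_of_heckeOrbit_pts`).
[cite: Milne2005ShimuraVarieties, Lemma 13.5 and Thm. 13.6 p. 118 L29–41] [cite: Shimura1998, §18.6 (pp. 124–127)] [cite: RapoportSmithlingZhang2020Diagonal, §3.2 p. 11] -/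
theorem RecordSystemGS.conjSlice_eq_sliceTwo_of_twisted_recip [IsSeparated M.hom]
    (hJ : (Jstar.map (IsCMField.complexConj L))ᵀ = Jstar) (hdet : IsUnit Jstar.det)
    (e : letI : Algebra L ℂ := τ.toAlgebra
      ComplexPoints ((Motives.baseChangeHom τ).obj (S.M.obj K)) ≃ₜ ShimuraSetGS L Jstar τ K.1.1)
    (he : letI : Algebra L ℂ := τ.toAlgebra
      ∀ (v : Fin 2 → ℂ) (hv : v ∈ negCone (Jstar.map τ))
        (b : ↥(finAdelic (↥(maximalRealSubfield L)) L (IsCMField.complexConj L) 2 Jstar)),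
        e.symm (ShimuraSetGS.mk L Jstar τ K.1.1 v hv b) =
          AlgPoints.baseChangeEquiv τ (S.M.obj K) ((S.pts K).symm (ShimuraSetGS.mk L Jstar τ K.1.1 v hv b)))
    (σL : letI : Algebra L ℂ := τ.toAlgebra; ℂ ≃ₐ[L] ℂ)
    {w : Fin 2 → L} (hw : (fun i => τ (w i)) ∈ negCone (Jstar.map τ)) {s' : (FiniteAdeleRing (𝓞 L) L)ˣ}
    (hs' : letI : Algebra L ℂ := τ.toAlgebra; IsArtinCorrespondent L τ s' σL⁻¹.toRingEquiv)
    {d' : ↥(finAdelic (↥(maximalRealSubfield L)) L (IsCMField.complexConj L) 2 Jstar)}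
    (hd' : IsDiagTwistGS L Jstar w (recipFactor L s') d')
    (T' : (Motives.baseChangeHom τ).obj (S.M.obj K) ⟶ (Motives.baseChange ℚ ℂ).obj M)
    (hT' : letI : Algebra L ℂ := τ.toAlgebra
      GaloisDescent.gal ℂ (S.M.obj K) σL⁻¹ ≫ t ≫ GaloisDescent.gal ℂ M (σL.restrictScalars ℚ) = T'.left)
    (htw : letI : Algebra L ℂ := τ.toAlgebra
      ∀ b : ↥(finAdelic (↥(maximalRealSubfield L)) L (IsCMField.complexConj L) 2 Jstar),
        (σL.restrictScalars ℚ) • f (ShimuraSetGS.mk L Jstar τ K.1.1 (fun i => τ (w i)) hw (d' * b)) =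
          f₂ (ShimuraSetGS.mk L Jstar τ K.1.1 (fun i => τ (w i)) hw b)) :
    T' = ψ₂ :=
  S.sliceComplex_ext_of_heckeOrbit_pts K M hJ hdet e he hw T' ψ₂ fun b =>
    S.map_conj_eq_sliceTwo_of_twisted_recip K M f f₂ ψ ψ₂ hψ hψ₂ t ht t₂ ht₂ σL hw hs' hd' T' hT' htw b

set_option maxHeartbeats 800000 in -- large adelic ∕ Shimura-set terms: instance-heavy statements (as ★ `UnitaryCurveSiegelDescent` §3)
include hψ hψ₂ ht ht₂ in
/-- **The same on underlying morphisms: `(1 × Spec σL) ≫ ψ ≫ (1 × Spec σL|_ℚ⁻¹) = ψ₂`**, i.e. `gal σL⁻¹ ≫ ψ.left ≫ gal σL|_ℚ = ψ₂.left` (the conjugate is a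
morphism over `ℂ`, ★ `GaloisDescent.gal_snd`). [cite: Milne2005ShimuraVarieties, Lemma 13.5 and Thm. 13.6 p. 118 L29–41] [cite: Shimura1998, §18.6 (pp. 124–127)] -/
theorem RecordSystemGS.gal_comp_sliceComplex_comp_gal_eq_sliceTwo [IsSeparated M.hom]
    (hJ : (Jstar.map (IsCMField.complexConj L))ᵀ = Jstar) (hdet : IsUnit Jstar.det)
    (e : letI : Algebra L ℂ := τ.toAlgebra
      ComplexPoints ((Motives.baseChangeHom τ).obj (S.M.obj K)) ≃ₜ ShimuraSetGS L Jstar τ K.1.1)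
    (he : letI : Algebra L ℂ := τ.toAlgebra
      ∀ (v : Fin 2 → ℂ) (hv : v ∈ negCone (Jstar.map τ))
        (b : ↥(finAdelic (↥(maximalRealSubfield L)) L (IsCMField.complexConj L) 2 Jstar)),
        e.symm (ShimuraSetGS.mk L Jstar τ K.1.1 v hv b) =
          AlgPoints.baseChangeEquiv τ (S.M.obj K) ((S.pts K).symm (ShimuraSetGS.mk L Jstar τ K.1.1 v hv b)))
    (σL : letI : Algebra L ℂ := τ.toAlgebra; ℂ ≃ₐ[L] ℂ)
    {w : Fin 2 → L} (hw : (fun i => τ (w i)) ∈ negCone (Jstar.map τ)) {s' : (FiniteAdeleRing (𝓞 L) L)ˣ}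
    (hs' : letI : Algebra L ℂ := τ.toAlgebra; IsArtinCorrespondent L τ s' σL⁻¹.toRingEquiv)
    {d' : ↥(finAdelic (↥(maximalRealSubfield L)) L (IsCMField.complexConj L) 2 Jstar)}
    (hd' : IsDiagTwistGS L Jstar w (recipFactor L s') d')
    (htw : letI : Algebra L ℂ := τ.toAlgebra
      ∀ b : ↥(finAdelic (↥(maximalRealSubfield L)) L (IsCMField.complexConj L) 2 Jstar),
        (σL.restrictScalars ℚ) • f (ShimuraSetGS.mk L Jstar τ K.1.1 (fun i => τ (w i)) hw (d' * b)) =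
          f₂ (ShimuraSetGS.mk L Jstar τ K.1.1 (fun i => τ (w i)) hw b)) :
    letI : Algebra L ℂ := τ.toAlgebra
    GaloisDescent.gal ℂ (S.M.obj K) σL⁻¹ ≫ t ≫ GaloisDescent.gal ℂ M (σL.restrictScalars ℚ) = t₂ := by
  letI iL : Algebra L ℂ := τ.toAlgebra
  have hspec : specAut ℂ σL = specAut ℂ (σL.restrictScalars ℚ) := specAut_restrictScalars_rat σL
  have hTsnd : t ≫ pullback.snd M.hom (bcSpec ℚ ℂ) = pullback.snd (S.M.obj K).hom (bcSpec L ℂ) := by rw [ht]; exact Over.w ψ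
  -- the conjugate is a morphism OVER `ℂ`
  have hw' : (GaloisDescent.gal ℂ (S.M.obj K) σL⁻¹ ≫ t ≫ GaloisDescent.gal ℂ M (σL.restrictScalars ℚ)) ≫
      pullback.snd M.hom (bcSpec ℚ ℂ) = pullback.snd (S.M.obj K).hom (bcSpec L ℂ) := by
    rw [Category.assoc, Category.assoc, GaloisDescent.gal_snd, ← Category.assoc t, hTsnd,
      GaloisDescent.gal_snd_assoc, inv_inv, hspec, AbelianVariety.specAut_comp_specAut_symm, Category.comp_id]
  let T' : (Motives.baseChangeHom τ).obj (S.M.obj K) ⟶ (Motives.baseChange ℚ ℂ).obj M :=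
    Over.homMk (GaloisDescent.gal ℂ (S.M.obj K) σL⁻¹ ≫ t ≫ GaloisDescent.gal ℂ M (σL.restrictScalars ℚ)) hw'
  have hT'T : T' = ψ₂ :=
    S.conjSlice_eq_sliceTwo_of_twisted_recip K M f f₂ ψ ψ₂ hψ hψ₂ t ht t₂ ht₂ hJ hdet e he σL hw hs' hd' T' rfl htw
  have h := congrArg (·.left) hT'T
  rw [← ht₂] at h
  exact h

end TwoSlices

end Literature.AlgebraicGeometry.ShimuraVarieties.UnitaryCanonicalModel

end
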